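import Literature.AlgebraicGeometry.Resolution.Kuhlmann2019Lemma43CaseTwo
import Literature.AlgebraicGeometry.Resolution.Kuhlmann2019Lemma42NormalForm
import Literature.AlgebraicGeometry.Resolution.KuhlmannVlahuThm111
import HarnessLib

/-!
# Kuhlmann 2019, Prop. 5.2 for separably closed ground fields — the named fact `Kuhlmann2019_Prop52_sepClosed` DISCHARGED

Topic: `Literature/AlgebraicGeometry/Resolution` (valued function fields). F.-V. Kuhlmann,
*Elimination of ramification II: Henselian rationality*, Israel J. Math. 234 (2019) =
arXiv:1701.05508, **Prop. 5.2** (p. 12 of the arXiv text):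

> **Proposition 5.2.** Take a valued function field `(F|K, v)` of transcendence degree 1 and
> rank 1. … assume that `K` is separable-algebraically closed. Then `F ⊆ K(y)^h` for some
> `y ∈ F` [more precisely: if `F ⊆ K(x)^h` for a transcendental `x`, then `F ⊆ K(y)^h` for
> some `y ∈ F`].

The tree reduced the named fact `Kuhlmann2019_Prop52_sepClosed`
(`Kuhlmann2019HenselianRationalityFiniteRank.lean`) along the printed proof to three statements
(`Kuhlmann2019_Prop52_sepClosed.of_normalForms`, `Kuhlmann2019DegreePStepAssembly.lean`):
`(H42)` = Lemma 4.2 as used in Prop. 4.8 — PROVED in `Kuhlmann2019Lemma42NormalForm.lean`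
(`Kuhlmann2019_Prop52_sepClosed.of_normalForm43`); `(hKV)` = [23, Thm. 11.1] as applied —
PROVED in `KuhlmannVlahuThm111.lean` (`kuhlmannVlahu_thm111`); and `(H43)` = Lemma 4.3 (the
Kummer normal form in mixed characteristic) as used in Prop. 4.9 — PROVED HERE
(`normalForm43`) from `Kuhlmann2019Lemma43Reduction.lean` (Kaplansky centre, the polynomial
`g̃`, first case, trivial radicands) and `Kuhlmann2019Lemma43CaseTwo.lean` (Ershov's cascade,
second case). Hence `Kuhlmann2019_Prop52_sepClosed_holds`.

## Content (everything PROVED; no definition, no named fact)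

* `normalForm43` — the hypothesis `(H43)` of `Kuhlmann2019_Prop52_sepClosed.of_normalForms`,
  verbatim.
* `Kuhlmann2019_Prop52_sepClosed_holds` — **the discharge of `Kuhlmann2019_Prop52_sepClosed`.**

## Sources

* [K19] F.-V. Kuhlmann, Israel J. Math. 234 (2019) = arXiv:1701.05508: Lemmas 4.2, 4.3, 4.7,
  Props. 4.8, 4.9, 5.2. [Kuhlmann2019]
* [23] F.-V. Kuhlmann, I. Vlahu, Math. Z. 276 (2014) = arXiv:1304.0200: Thm. 11.1.
* [KK09] H. Knaf, F.-V. Kuhlmann, Adv. Math. 221 (2009): Lemma 2.16. [KnafKuhlmann2009]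
-/

noncomputable section

open IsLocalRing Polynomial

namespace Literature.AlgebraicGeometry.Resolution

universe u

/-- **Kuhlmann 2019, Lemma 4.3 as used in the proof of Prop. 4.9 — the hypothesis `(H43)` of
`Kuhlmann2019_Prop52_sepClosed.of_normalForms`, verbatim.** For `K ≤ Ω` separably closed of
characteristic `0` and rank one, `char Ωv = p`, `z` transcendental over `K` with `(K(z)|K, v)`
immediate, and `f` over `K` with `v(f(z)) < 1`: there are `c ∈ K`, `0 ≠ d ∈ K` with
`v((z−c)/d) = 1` and `g` over `K` with `1 + f(z) ∈ (1 + g((z−c)/d))·(K(z)^h)^{×p}` and an index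
`i₀ ≥ 1` prime to `p` with `g_{i₀} ≠ 0` strictly dominating all other coefficients of positive
index. PROVED: trivial radicands by `normalForm43_of_pow_eq`; otherwise
`normalForm43_or_caseTwo` (first case) or `normalForm43_caseTwo` (second case) after the
substitution `y = (z − c)/d`, `K(y) = K(z)`. [cite: Kuhlmann2019, Lemma 4.3] -/
theorem normalForm43 : ∀ (Ω : Type u) [Field Ω] [IsAlgClosed Ω] (V : ValuationSubring Ω) (p : ℕ)
    [Fact p.Prime] [CharZero Ω] [CharP (ResidueField V) p] (K : Subfield Ω),
    IsSepClosed K → IsRankOne V K →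
    ∀ (z : Ω), Transcendental K z →
    IsImmediateOver V K (Subfield.closure ((K : Set Ω) ∪ {z})) →
    ∀ f : Polynomial Ω, (∀ k, f.coeff k ∈ K) → V.valuation (f.eval z) < 1 →
    ∃ c ∈ K, ∃ d ∈ K, d ≠ 0 ∧ V.valuation ((z - c) / d) = 1 ∧
    ∃ g : Polynomial Ω, (∀ k, g.coeff k ∈ K) ∧
      (∃ w ∈ henselization V (Subfield.closure ((K : Set Ω) ∪ {z})), w ≠ 0 ∧
        1 + f.eval z = (1 + g.eval ((z - c) / d)) * w ^ p) ∧
      (∃ i₀, 0 < i₀ ∧ ¬ p ∣ i₀ ∧ g.coeff i₀ ≠ 0 ∧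
        ∀ i, 0 < i → i ≠ i₀ → V.valuation (g.coeff i) < V.valuation (g.coeff i₀)) := by
  intro Ω _ _ V p _ _ _ K hK hr z hz himm f hf hfz
  haveI := hK
  by_cases htriv : ∃ w₀ ∈ henselization V (Subfield.closure ((K : Set Ω) ∪ {z})),
      w₀ ^ p = 1 + f.eval z
  · obtain ⟨w₀, hw₀, hfw₀⟩ := htriv
    exact normalForm43_of_pow_eq V K hr hz himm hfz hw₀ hfw₀
  rcases normalForm43_or_caseTwo V K hr hz himm hf hfz htriv with
    hdone | ⟨c, hcK, d, hdK, hd0, hy1, g, hgK, hgv, w, hwF, hw0, hw⟩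
  · exact hdone
  -- second case, in the variable `y = (z - c)/d`
  have hKy : Subfield.closure ((K : Set Ω) ∪ {(z - c) / d}) = Subfield.closure ((K : Set Ω) ∪ {z}) :=
    closure_insert_sub_div_eq K hcK hdK hd0 z
  have hyt : Transcendental K ((z - c) / d) := transcendental_sub_div K hcK hdK hd0 hz
  have himm' : IsImmediateOver V K (Subfield.closure ((K : Set Ω) ∪ {(z - c) / d})) := by
    rw [hKy]; exact himm
  have hnt : ¬ ∃ w' ∈ henselization V (Subfield.closure ((K : Set Ω) ∪ {(z - c) / d})),
      w' ^ p = 1 + g.eval ((z - c) / d) := by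
    rintro ⟨w', hw', hw'p⟩
    rw [hKy] at hw'
    exact htriv ⟨w' * w, mul_mem hw' hwF, by rw [mul_pow, hw'p, ← hw]⟩
  obtain ⟨c₂, hc₂K, b, hbK, hb0, hzt, G, hGK, ⟨w₂, hw₂F, hw₂0, hw₂⟩, i₀, hi₀, hpi₀, hG0, hdom⟩ :=
    normalForm43_caseTwo V K hyt himm' hy1 hgK hgv hnt
  rw [hKy] at hw₂F
  have key : (z - (c + d * c₂)) / (d * b) = ((z - c) / d - c₂) / b := by
    field_simp
    ring
  refine ⟨c + d * c₂, add_mem hcK (mul_mem hdK hc₂K), d * b, mul_mem hdK hbK, mul_ne_zero hd0 hb0,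
    ?_, G, hGK, ⟨w₂ * w, mul_mem hw₂F hwF, mul_ne_zero hw₂0 hw0, ?_⟩, i₀, hi₀, hpi₀, hG0, hdom⟩
  · rw [key]; exact hzt
  · rw [key, hw, hw₂, mul_pow]; ring

/-- **Kuhlmann 2019, Prop. 5.2 for separably closed ground fields of rank one — DISCHARGE of
the named fact `Kuhlmann2019_Prop52_sepClosed`** (`Kuhlmann2019HenselianRationalityFiniteRank.lean`):
`Kuhlmann2019_Prop52_sepClosed.of_normalForm43` (Lemma 4.2 proved there) applied to `(H43)` =
`normalForm43` and `(hKV)` = `kuhlmannVlahu_thm111`. Everything along the printed proof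
(Lemmas 4.1–4.3, 4.7, 5.1, 5.4, Props. 4.8, 4.9, [23, Thm. 11.1] as applied, Knaf–Kuhlmann
2009 Lemma 2.16) is PROVED in the tree. [cite: Kuhlmann2019, Prop. 5.2] -/
theorem Kuhlmann2019_Prop52_sepClosed_holds : Kuhlmann2019_Prop52_sepClosed.{u} :=
  Kuhlmann2019_Prop52_sepClosed.of_normalForm43 normalForm43
    fun _ _ _ V K F y hK hr hKF hfg hsg h1 himm hy hyt hF =>
      kuhlmannVlahu_thm111 V K F y hK hr hKF hfg hsg h1 himm hy hyt hF

end Literature.AlgebraicGeometry.Resolution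

end
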